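import Summits.ResolutionOfSingularities.ResolutionOfSingularities.Theorems.HilbertSamuelEliminationSigmaMaxModificationsCorridor3WLadderLocalChainsDefs
import Summits.ResolutionOfSingularities.ResolutionOfSingularities.Theorems.HilbertSamuelEliminationSigmaMaxModificationsCorridor3WLadderStrataCentre
import Summits.ResolutionOfSingularities.ResolutionOfSingularities.Theorems.HilbertSamuelEliminationSigmaMaxModificationsCorridor3WLadderMovingIsoDefs
import HarnessLib

/-!
# [OURS · L1 W4.2] The H-LAYER (generic-point descent), part 2/2 — the PROVED compositions: row (c-geo)
# `StrataLineageInCentreIO p 3 Q G` for EVERY `Q` and `G` from the transfer row and the kill row, and the joins by name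
# into row (c), stub-4's `Wlow3CharStrataM p`, res-type-012's `WtopEvNonIsoM p Q` and THE CORE `Wtop3NonpointedM p` (cover B)

Crux chain w42 (`SigmaMaxModifications`, stmt-ResolutionOfSingularities-18506; skeleton `w_ladder` v6 on
`SigmaMaxModificationsCorridor3`, stmt-ResolutionOfSingularities-19249), W4.2 DEAL of res-L1-w42-plan-1 (2026-08-27 07:34:07Z)
object D1 (ii) «H-LAYER», from res-L1-w42-idea-2's card-H line `Line-wtop-product.lean` v2.1 (ea8a854e4ebcec71) §3, its two
`stub_*` and the assemblies through them OMITTED (they are the W4.2 DEAL objects D3 `movingLineageLocalizesM_holds` / D6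
`localNearPointChainsTerminate_of_printedFacts`). Definitions: part 1/2 `…Corridor3WLadderLocalChainsDefs` (`IsMovingLineage`,
`LocalNearPointChainsTerminate` — tri-2-sharpened level clause `< N` —, `LocalPrintedFacts`, `MovingLineageLocalizesM`).
OURS (cell res-hironaka, slot W4.2); NOT statements of H. Hironaka's manuscript [Hironaka2017] nor of [CossartJannsenSaito2020];
AI-drafted, weaker than expert review. Every `theorem` below is PROVED (pure compositions; the open content is the two rows taken
as hypotheses). Helper file `--supports stmt-ResolutionOfSingularities-19249`.

## What is proved (namespace `…Theorems.SigmaMaxModificationsCorridor3.Moving`)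

* `strataLineageInCentreIO_of_localChains : MovingLineageLocalizesM p → LocalNearPointChainsTerminate → ∀ Q G,
  StrataLineageInCentreIO p 3 Q G` — the unused hypotheses `Q`, `G`, «moving» of (c-geo) are dropped; the kill row is used at
  level `N = 3 > 2 ≥ dim S_0` (this is where tri-2's sharpened clause `topologicalKrullDim (S 0) < N` is met).
* `strataLineagesFinite_of_localChains` (+ (c-rep), by stub-4's `strataLineagesFinite_of_centreIO_of_replaySettle`, p503885).
* `wlow3CharStrataM_of_localChains` (+ (b)₂, (c-rep)₂: stub-4's `Wlow3CharStrataM p`, by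
  `wlow3CharStrataM_of_births_centreIO_replaySettle`) — the descent is by codimension, not by grade.
* `wtopEvNonIsoM_of_localChains : MovingLineageLocalizesM p → LocalNearPointChainsTerminate → StrataBirthsSettle p 3 Q (3 ≤ ē) →
  StrataReplayBlowupsSettle p 3 Q (3 ≤ ē) → WtopEvNonIsoM p Q` (res-type-012's row, p500943; Kőnig by p500484's
  `maxOriginNoMovingNearChainAtQ_notIso_of_lineages`).
* `wtop3NonpointedM_of_recIso_of_localChains` — THE CORE `Wtop3NonpointedM p` by cover B over res-type-012's isolated-recurrent
  row `WtopRecIsoM p QNonpointed` (`maxOriginNoMovingNearChainAtQ_of_recurrence`, p500148).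

References: CJS LNM 2270 Lemma 6.30, p. 98 Step 9, Prop. 6.31, Rem. 6.29 (1), Thm. 6.35, Cor. 6.37, Thm. 6.40, p. 105, p. 107
[CossartJannsenSaito2020]; tree `…WLadderStrataLineages` (p500484), `…WLadderStrataLabels` (p503069), `…WLadderStrataCentre`
(p503885), `…WLadderMovingIsoDefs` (p500943), `…WLadderMovingRows`; L/res-L1-w42-idea-2/idea-generic-point-descent.md;
L/res-L1-w42-tri-2/TRIAGE-v5.1.md R5-H.
-/

noncomputable section

-- plan-1/idea-2 module setting kept (namespace `…Corridor3.Moving` re-enters `…Corridor3`)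
set_option linter.dupNamespace false

open CategoryTheory AlgebraicGeometry TopologicalSpace Topology
open Summit.ResolutionOfSingularities.ResolutionOfSingularities.Theorems.CampaignW42
open Literature.AlgebraicGeometry.Resolution Literature.RingTheory.HilbertSamuel
open Literature.AlgebraicGeometry.CossartJannsenSaito2020
open Summit.ResolutionOfSingularities.ResolutionOfSingularities.Theorems.SigmaMaxModificationsCorridor3
open Summit.ResolutionOfSingularities.ResolutionOfSingularities.Cruxes.SigmaMaxModifications.IdeasL1Idea2R4
  (QNonpointed WtopEvNonIsoM WtopRecIsoM)

universe u

namespace Summit.ResolutionOfSingularities.ResolutionOfSingularities.Theorems.SigmaMaxModificationsCorridor3.Moving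

/-- **ROW (c-geo) `StrataLineageInCentreIO p 3 Q G` (stub-4, p503069) FOR EVERY ORIGIN PREDICATE AND EVERY GRADE, FROM THE
TRANSFER AND THE KILL — PROVED** (the unused hypotheses `Q`, `G`, «moving» of the row are simply dropped; the kill row is used at
level `3 > 2 ≥ dim S_0`). [cite: CossartJannsenSaito2020, Lemma 6.30, p. 98 Step 9, Cor. 6.37, Thm. 6.40] -/
theorem strataLineageInCentreIO_of_localChains {p : ℕ} (hT : MovingLineageLocalizesM.{u} p)
    (hK : LocalNearPointChainsTerminate.{u}) (Q : ℕ → (ℕ → ℕ) → ∀ X : Scheme.{u}, X → Prop)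
    (G : MarkedStage.{u} → Prop) : StrataLineageInCentreIO.{u} p 3 Q G := by
  intro R hRf hRa ν X _ x hX _ c h0 hstep _ hnot _
  rintro ⟨Z, hZ⟩
  obtain ⟨S, ln, pt, hexc, hred, hdim, hchain, hiso⟩ := hT R hRf hRa ν X x hX c h0 hstep hnot Z hZ
  have h23 : (2 : WithBot ℕ∞) < ((3 : ℕ) : WithBot ℕ∞) := by decide
  exact hK 3 S ln pt hexc hred hdim (hdim.trans_lt h23) hchain hiso

/-- **ROW (c) `StrataLineagesFinite p 3 Q G` FROM THE TRANSFER, THE KILL AND (c-rep)** — by stub-4's PROVED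
`strataLineagesFinite_of_centreIO_of_replaySettle` (p503885). [cite: CossartJannsenSaito2020, Rem. 6.29 (1), p. 105] -/
theorem strataLineagesFinite_of_localChains {p : ℕ} (hT : MovingLineageLocalizesM.{u} p)
    (hK : LocalNearPointChainsTerminate.{u}) {Q : ℕ → (ℕ → ℕ) → ∀ X : Scheme.{u}, X → Prop}
    {G : MarkedStage.{u} → Prop} (hrep : StrataReplayBlowupsSettle.{u} p 3 Q G) : StrataLineagesFinite.{u} p 3 Q G :=
  strataLineagesFinite_of_centreIO_of_replaySettle (strataLineageInCentreIO_of_localChains hT hK Q G) hrep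

/-- **W-low: stub-4's `Wlow3CharStrataM p` FROM THE TRANSFER, THE KILL, (b)₂ AND (c-rep)₂** — the descent is by codimension, not by
grade, so the same two rows serve `G = (ē ≤ 2)` (by `wlow3CharStrataM_of_births_centreIO_replaySettle`, p503885).
[cite: CossartJannsenSaito2020, Thm. 6.35, Prop. 6.31, Rem. 6.29 (1)] -/
theorem wlow3CharStrataM_of_localChains {p : ℕ} (hT : MovingLineageLocalizesM.{0} p) (hK : LocalNearPointChainsTerminate.{0})
    (hB : StrataBirthsSettle.{0} p 3 (Helpers.QCharRegime p) fun s => s.geomDirDim ≤ 2)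
    (hrep : StrataReplayBlowupsSettle.{0} p 3 (Helpers.QCharRegime p) fun s => s.geomDirDim ≤ 2) : Wlow3CharStrataM p :=
  wlow3CharStrataM_of_births_centreIO_replaySettle hB (strataLineageInCentreIO_of_localChains hT hK _ _) hrep

/-- **W-top, any origin predicate `Q`: res-type-012's `WtopEvNonIsoM p Q` (p500943) FROM THE TRANSFER, THE KILL, (b)₃ AND (c-rep)₃**
(Kőnig by p500484's `maxOriginNoMovingNearChainAtQ_notIso_of_lineages`). [cite: CossartJannsenSaito2020, Thm. 6.35, Lemma 6.30] -/
theorem wtopEvNonIsoM_of_localChains {p : ℕ} (hT : MovingLineageLocalizesM.{u} p) (hK : LocalNearPointChainsTerminate.{u})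
    {Q : ℕ → (ℕ → ℕ) → ∀ X : Scheme.{u}, X → Prop}
    (hB : StrataBirthsSettle.{u} p 3 Q fun s => 3 ≤ s.geomDirDim)
    (hrep : StrataReplayBlowupsSettle.{u} p 3 Q fun s => 3 ≤ s.geomDirDim) : WtopEvNonIsoM.{u} p Q :=
  maxOriginNoMovingNearChainAtQ_notIso_of_lineages hB (strataLineagesFinite_of_localChains hT hK hrep)

/-- **THE CORE BY COVER B: `Wtop3NonpointedM p` FROM res-type-012's isolated-recurrent row `WtopRecIsoM p QNonpointed` (p500943),
THE TRANSFER, THE KILL, (b)₃ AND (c-rep)₃ at `Q = QNonpointed`** — by name (`maxOriginNoMovingNearChainAtQ_of_recurrence`).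
[cite: CossartJannsenSaito2020, Thm. 6.40, Thm. 6.35] -/
theorem wtop3NonpointedM_of_recIso_of_localChains {p : ℕ} (hI : WtopRecIsoM.{u} p QNonpointed)
    (hT : MovingLineageLocalizesM.{u} p) (hK : LocalNearPointChainsTerminate.{u})
    (hB : StrataBirthsSettle.{u} p 3 QNonpointed fun s => 3 ≤ s.geomDirDim)
    (hrep : StrataReplayBlowupsSettle.{u} p 3 QNonpointed fun s => 3 ≤ s.geomDirDim) : Moving.Wtop3NonpointedM.{u} p :=
  maxOriginNoMovingNearChainAtQ_of_recurrence (Q := QNonpointed) (G := fun s => 3 ≤ s.geomDirDim) (B := Iso 3)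
    (wtopEvNonIsoM_of_localChains hT hK hB hrep) hI

end Summit.ResolutionOfSingularities.ResolutionOfSingularities.Theorems.SigmaMaxModificationsCorridor3.Moving
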